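import Summits.Ventures.WeilGRH.GL2LevelLaw
import Summits.Ventures.WeilGRH.MinorantZetaTransferEnergy
import HarnessLib

/-!
# GRH arm (rh-explicit, WeilGRH / GL₂-ext): GL₂ CERTIFICATE FORMAT and THE LEVEL LAW WITH THE PARITY BONUS (weil-grh-2 gen6)

Sequel of `GL2LevelLaw.lean`.  The duplication identity `Re ψ(¼+iτ/2) + Re ψ(¾+iτ/2) = 2Re ψ(½+iτ) − 2log 2`
(`re_digamma_quarter_add_three_quarters`) with `Re ψ(½+iτ) ≤ Re ψ(1+iτ) ≤ Re ψ(m+iτ)` KEEPS the odd archimedean part: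
`Re Q_f(g) ≥ E_{0,(log N)/2,v}(g) + E_{1,(log N)/2,v}(g)`, `v = Λ_f/(2Λ)`, `‖v‖ ≤ 1`.  Both key forms are minorised by
their all-trivial keys at `|g|` (`keyMarkovForm_norm_le_of_level_le`); a JOINT same-window transfer (one dilation +
mollification sequence for the two forms, `exists_isWeilTest_keyMarkovForm_add_lt_of_lipschitz`) reduces to test functions.

**CERTIFICATE FORMAT (`weilPositivityOnGL2_of_allTrivial_pair_nonneg`).**  ONE inequality — the all-trivial even + odd
key pair of level `(log N)/2` is `≥ 0` on the tests of `[-t, t]` — gives `WeilPositivityOnGL2 k N Λf t` for EVERY even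
`k ≥ 2` and every datum with `‖Λf n‖ ≤ 2Λ(n)` (the GL₂ analogue of `weilPositivityOnChar_of_allTrivial_test_nonneg`).
**LEVEL LAW (`weilPositivityOnGL2_of_groundEnergy_parity`, `…_of_weilPositivityOn_parity`).**  On tests
`E₀ + E₁ = 2Re Q_ζ − 2P + Π + log N‖g‖²` (`keyMarkovForm_one_eq_zero_add_sech`), `Re Q_ζ ≥ weilGroundEnergy(t)‖g‖²`,
`P ≤ 2‖x‖²`, `Π ≥ 2‖Y‖²`, `(1 − 2β²)(4‖x‖² − 2‖Y‖²) = 4‖x + βY‖² − 2‖2βx + Y‖² ≤ 4E(t,β)‖g‖₂²`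
(`integral_Icc_cosh_add_sech_sq`): `2β² < 1` and `4(sinh t + t + 2βt + β²tanh(t/2)) ≤ (1 − 2β²)(log N + 2·weilGroundEnergy t)`
— in particular `≤ (1 − 2β²) log N` under `WeilPositivityOn t` — suffice.  Named levels (`β = −1/4`: `log 2 ⇒ N ≥ 168`,
`4023/5000 ⇒ 420`, … ; `GL2LevelLaw`: 324 / 900) are in `GL2LevelLawParityRungs.lean`.  Everything PROVED; no defs,
no named facts.
-/

set_option autoImplicit false

noncomputable section

open Complex Set MeasureTheory Finset Filter
open scoped Real ComplexConjugate ArithmeticFunction.vonMangoldt Topology Convolution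

namespace Summit.Ventures.WeilGRH

open Literature.NumberTheory.LFunctions Literature.Analysis.SpecialFunctions.Complex
open Summit.RiemannHypothesis.RiemannHypothesis.Theorems.WeilFormatC

variable {b : ℝ} {u g : ℝ → ℂ}

/-! ## Joint same-window transfer for a SUM of two key forms -/

/-- **Mollification step for two forms at once**: `u` a window function on `[-b, b]`, `0 ≤ b < t`, and
`keyMarkovForm a₁ L₁ v₁ t u + keyMarkovForm a₂ L₂ v₂ t u < B‖u‖₂²` ⇒ a TEST function on `[-t, t]` with the same strict
inequality (one bump sequence, `eventually_keyMarkovForm_mollify_le` for each form). [folklore] -/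
theorem exists_isWeilTest_keyMarkovForm_add_lt (hb : 0 ≤ b) (hu : IsWindowFunction b u) {t : ℝ} (hbt : b < t)
    (a₁ a₂ : ℕ) (L₁ L₂ : ℝ) (v₁ v₂ : ℕ → ℂ) {B : ℝ}
    (hB : keyMarkovForm a₁ L₁ v₁ t u + keyMarkovForm a₂ L₂ v₂ t u < B * ∫ x, ‖u x‖ ^ 2) :
    ∃ g : ℝ → ℂ, IsWeilTest g ∧ tsupport g ⊆ Icc (-t) t ∧
      keyMarkovForm a₁ L₁ v₁ t g + keyMarkovForm a₂ L₂ v₂ t g < B * ∫ x, ‖g x‖ ^ 2 := by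
  set r₀ : ℝ := min 1 (t - b) with hr₀
  have hr₀0 : 0 < r₀ := lt_min one_pos (by linarith)
  set r : ℕ → ℝ := fun i ↦ r₀ * (1 / ((i : ℝ) + 1)) with hr
  have hrpos : ∀ i, 0 < r i := fun i ↦ by positivity
  have hrle : ∀ i, r i ≤ r₀ := fun i ↦ mul_le_of_le_one_right hr₀0.le
    ((div_le_one (by positivity)).2 (by linarith [Nat.cast_nonneg (α := ℝ) i]))
  let φ : ℕ → ContDiffBump (0 : ℝ) := fun i ↦ ⟨r i / 2, r i, half_pos (hrpos i), half_lt_self (hrpos i)⟩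
  have hφ : Tendsto (fun i ↦ (φ i).rOut) atTop (𝓝 0) := by
    show Tendsto r atTop (𝓝 0)
    simpa [hr] using (tendsto_one_div_add_atTop_nhds_zero_nat (𝕜 := ℝ)).const_mul r₀
  have h'φ : ∀ᶠ i in atTop, (φ i).rOut ≤ 2 * (φ i).rIn :=
    Eventually.of_forall fun i ↦ by show r i ≤ 2 * (r i / 2); linarith
  have h1 : ∀ i, (φ i).rOut ≤ 1 := fun i ↦ (hrle i).trans (min_le_left _ _)
  set gap : ℝ := B * (∫ x, ‖u x‖ ^ 2) - (keyMarkovForm a₁ L₁ v₁ t u + keyMarkovForm a₂ L₂ v₂ t u) with hgap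
  have hgap0 : 0 < gap := by rw [hgap]; linarith
  set δ : ℝ := gap / (4 * (1 + |B|)) with hδ
  have hδ0 : 0 < δ := by rw [hδ]; positivity
  obtain ⟨i, ⟨hK1, hN1⟩, ⟨hK2, -⟩⟩ :=
    ((eventually_keyMarkovForm_mollify_le hb hu hφ h'φ h1 a₁ L₁ v₁ t hδ0).and
      (eventually_keyMarkovForm_mollify_le hb hu hφ h'φ h1 a₂ L₂ v₂ t hδ0)).exists
  have hrt : (φ i).rOut ≤ t - b := (hrle i).trans (min_le_right _ _)
  refine ⟨(φ i).normed volume ⋆[ContinuousLinearMap.lsmul ℝ ℝ, volume] u, isWeilTest_mollify (φ i) hu,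
    (tsupport_mollify_subset (φ i) hu).trans (Icc_subset_Icc (by linarith) (by linarith)), ?_⟩
  · set Ni : ℝ := ∫ x, ‖((φ i).normed volume ⋆[ContinuousLinearMap.lsmul ℝ ℝ, volume] u) x‖ ^ 2 with hNidef
    set Nu : ℝ := ∫ x, ‖u x‖ ^ 2 with hNudef
    have hBN : B * Nu - B * Ni ≤ |B| * δ := by
      calc B * Nu - B * Ni = B * (Nu - Ni) := by ring
        _ ≤ |B * (Nu - Ni)| := le_abs_self _
        _ = |B| * |Ni - Nu| := by rw [abs_mul, abs_sub_comm]
        _ ≤ |B| * δ := mul_le_mul_of_nonneg_left hN1.le (abs_nonneg _)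
    have hδid : δ * (4 * (1 + |B|)) = gap := by rw [hδ]; field_simp
    nlinarith [abs_nonneg B]

/-- **Same-window transfer for two forms**: `u` a window function on `[-b, b]` (`b > 0`), Lipschitz on `ℝ`, with
`keyMarkovForm a₁ L₁ v₁ b u + keyMarkovForm a₂ L₂ v₂ b u < B‖u‖₂²` ⇒ a TEST function on `[-b, b]` with the same strict
inequality (ONE dilation family of `KeyWindowDilation.exists_dilation_family`, both forms converge along it). [folklore] -/
theorem exists_isWeilTest_keyMarkovForm_add_lt_of_lipschitz (hb : 0 < b) (hu : IsWindowFunction b u) {K : ℝ}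
    (hK : ∀ x y, ‖u y - u x‖ ≤ K * |y - x|) (a₁ a₂ : ℕ) (L₁ L₂ : ℝ) (v₁ v₂ : ℕ → ℂ) {B : ℝ}
    (hB : keyMarkovForm a₁ L₁ v₁ b u + keyMarkovForm a₂ L₂ v₂ b u < B * ∫ x, ‖u x‖ ^ 2) :
    ∃ g : ℝ → ℂ, IsWeilTest g ∧ tsupport g ⊆ Icc (-b) b ∧
      keyMarkovForm a₁ L₁ v₁ b g + keyMarkovForm a₂ L₂ v₂ b g < B * ∫ x, ‖g x‖ ^ 2 := by
  obtain ⟨w, r, S, δ, hr, hwin, hwm, hwz, hwb, hwl, hnear, hδ⟩ := exists_dilation_family hb hu hK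
  have hf₁ := tendsto_keyMarkovForm_of_uniform hb hwm hwz hwb hwl hnear hδ a₁ L₁ v₁ b
  have hf₂ := tendsto_keyMarkovForm_of_uniform hb hwm hwz hwb hwl hnear hδ a₂ L₂ v₂ b
  have hnorm := tendsto_integral_norm_sq_of_uniform hwm hwz hwb hnear hδ
  have hev : ∀ᶠ i in atTop,
      keyMarkovForm a₁ L₁ v₁ b (w i) + keyMarkovForm a₂ L₂ v₂ b (w i) - B * ∫ x, ‖w i x‖ ^ 2 < 0 :=
    ((hf₁.add hf₂).sub (hnorm.const_mul B)).eventually (gt_mem_nhds (by linarith))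
  obtain ⟨i, hi⟩ := hev.exists
  exact exists_isWeilTest_keyMarkovForm_add_lt (hr i).1 (hwin i) (hr i).2 a₁ a₂ L₁ L₂ v₁ v₂ (B := B) (by linarith)

/-- **Joint consumer of the minorant**: if the all-trivial EVEN + ODD key forms of level `L₀` sum to `≥ 0` at every
test function on `[-b, b]` (`b > 0`), then for every datum with `‖v n‖ ≤ 1`, every `L ≥ L₀` and every test `g` on
`[-b, b]`: `0 ≤ keyMarkovForm 0 L v b g + keyMarkovForm 1 L v b g`. [folklore] -/
theorem keyMarkovForm_add_nonneg_of_allTrivial_test_nonneg {L₀ L : ℝ} (hb : 0 < b)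
    (hpos : ∀ h : ℝ → ℂ, IsWeilTest h → tsupport h ⊆ Icc (-b) b →
      0 ≤ keyMarkovForm 0 L₀ (fun _ ↦ 1) b h + keyMarkovForm 1 L₀ (fun _ ↦ 1) b h)
    {v : ℕ → ℂ} (hv : ∀ n, ‖v n‖ ≤ 1) (hL : L₀ ≤ L) (hg : IsWeilTest g) (hsupp : tsupport g ⊆ Icc (-b) b) :
    0 ≤ keyMarkovForm 0 L v b g + keyMarkovForm 1 L v b g := by
  have hw := isWindowFunction_of_isWeilTest hg hsupp
  have h0 := keyMarkovForm_norm_le_of_level_le hb.le hw 0 hL hv b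
  have h1 := keyMarkovForm_norm_le_of_level_le hb.le hw 1 hL hv b
  refine le_trans ?_ (add_le_add h0 h1)
  by_contra hneg
  obtain ⟨K, hK⟩ := exists_lipschitz_norm_of_isWeilTest hg
  have hlt : keyMarkovForm 0 L₀ (fun _ ↦ 1) b (fun x ↦ ((‖g x‖ : ℝ) : ℂ)) +
      keyMarkovForm 1 L₀ (fun _ ↦ 1) b (fun x ↦ ((‖g x‖ : ℝ) : ℂ)) < 0 * ∫ x, ‖(((‖g x‖ : ℝ) : ℂ))‖ ^ 2 := by
    rw [zero_mul]
    exact not_le.1 hneg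
  obtain ⟨h', hh', hsupp', hlt'⟩ := exists_isWeilTest_keyMarkovForm_add_lt_of_lipschitz hb
    (isWindowFunction_norm hw) hK 0 1 L₀ L₀ (fun _ ↦ 1) (fun _ ↦ 1) hlt
  rw [zero_mul] at hlt'
  exact absurd (hpos h' hh' hsupp') (not_le.2 hlt')

/-! ## The all-trivial EVEN + ODD pair above the parity budget is non-negative (ground-energy form) -/

/-- For a test function `g` on `[-t, t]` (`t ≥ 0`), `2β² < 1` and `4E(t, β) ≤ (1 − 2β²)·2(L + E₀(t))`, `E₀ = weilGroundEnergy`: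
`0 ≤ keyMarkovForm 0 L 1 t g + keyMarkovForm 1 L 1 t g` (`E₀ + E₁ = 2Re Q_ζ − 2P + Π + 2L‖g‖²`, `Re Q_ζ ≥ E₀(t)‖g‖²`,
`(1−2β²)(4‖x‖² − 2‖Y‖²) = 4‖x + βY‖² − 2‖2βx + Y‖²`). [cite: Bombieri2000, §4 Problem 2 (ground energy)] -/
theorem keyMarkovForm_allTrivial_pair_nonneg_of_groundEnergy {t : ℝ} (ht : 0 ≤ t) {β : ℝ} (hβ : 2 * β ^ 2 < 1)
    {L : ℝ} (hL : 4 * (Real.sinh t + t + 2 * β * t + β ^ 2 * Real.tanh (t / 2)) ≤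
      (1 - 2 * β ^ 2) * (2 * (L + weilGroundEnergy t)))
    (hg : IsWeilTest g) (hsupp : tsupport g ⊆ Icc (-t) t) :
    0 ≤ keyMarkovForm 0 L (fun _ ↦ 1) t g + keyMarkovForm 1 L (fun _ ↦ 1) t g := by
  rw [keyMarkovForm_one_eq_zero_add_sech hg hsupp, keyMarkovForm_allTrivial_zero_eq,
    weilWindowForm_eq_re_weilQuadratic hg hsupp]
  set x : ℂ := ∫ u : ℝ, g u * (Real.cosh (u / 2) : ℂ) with hx
  set s : ℂ := ∫ u : ℝ, g u * (Real.sinh (u / 2) : ℂ) with hs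
  set Y : ℂ := ∫ u : ℝ, g u / (2 * Real.cosh (u / 2) : ℂ) with hY
  set S : ℝ := 1 / (2 * π) * ∫ τ : ℝ, ‖weilMellin g (1 / 2 + τ * I)‖ ^ 2 * (π / Real.cosh (π * τ)) with hS
  set Ng : ℝ := ∫ u : ℝ, ‖g u‖ ^ 2 with hNg
  set E : ℝ := Real.sinh t + t + 2 * β * t + β ^ 2 * Real.tanh (t / 2) with hE
  have hP : weilPoleForm g = 2 * ‖x‖ ^ 2 - 2 * ‖s‖ ^ 2 := rfl
  have h1 : weilGroundEnergy t * Ng ≤ (weilQuadratic g).re := ConnesVanSuijlekom.weilGroundEnergy_mul_le_re hg hsupp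
  have hSY : 2 * ‖Y‖ ^ 2 ≤ S := two_mul_norm_sq_sech_pairing_le hg
  have hNg0 : 0 ≤ Ng := integral_nonneg fun _ ↦ by positivity
  have hprof : Continuous fun u : ℝ ↦ Real.cosh (u / 2) + β / (2 * Real.cosh (u / 2)) :=
    Continuous.add (by fun_prop) (Continuous.div continuous_const (by fun_prop) fun u ↦ by positivity)
  have hCS : ‖x + (β : ℂ) * Y‖ ^ 2 ≤ E * Ng := by
    rw [hx, hY, integral_mul_cosh_add_mul_integral_sech hg β, hE, ← integral_Icc_cosh_add_sech_sq ht β]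
    exact norm_sq_integral_mul_real_le hg ht hsupp hprof
  have hid : (1 - 2 * β ^ 2) * (4 * ‖x‖ ^ 2 - 2 * ‖Y‖ ^ 2) =
      4 * ‖x + (β : ℂ) * Y‖ ^ 2 - 2 * ‖2 * (β : ℂ) * x + Y‖ ^ 2 := by
    simp only [Complex.sq_norm, Complex.normSq_apply, Complex.add_re, Complex.add_im, Complex.mul_re,
      Complex.mul_im, Complex.ofReal_re, Complex.ofReal_im, Complex.re_ofNat, Complex.im_ofNat]
    ring
  have hkey : (1 - 2 * β ^ 2) * (4 * ‖x‖ ^ 2 - 2 * ‖Y‖ ^ 2) ≤ 4 * E * Ng := by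
    rw [hid]; nlinarith [sq_nonneg ‖2 * (β : ℂ) * x + Y‖]
  have hγ' : 0 < 1 - 2 * β ^ 2 := by linarith
  have hL' : 4 * E * Ng ≤ (1 - 2 * β ^ 2) * (2 * (L + weilGroundEnergy t)) * Ng := mul_le_mul_of_nonneg_right hL hNg0
  have h2 : (1 - 2 * β ^ 2) * (4 * ‖x‖ ^ 2 - 2 * ‖Y‖ ^ 2) ≤
      (1 - 2 * β ^ 2) * (2 * (L + weilGroundEnergy t) * Ng) := by nlinarith
  have h3 : 4 * ‖x‖ ^ 2 - 2 * ‖Y‖ ^ 2 ≤ 2 * (L + weilGroundEnergy t) * Ng := le_of_mul_le_mul_left h2 hγ'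
  rw [hP]
  nlinarith [sq_nonneg ‖s‖]

/-! ## The GL₂ prime sum against a key `v` with `v(n) = Λ_f(n)/(2Λ(n))` -/

/-- `‖Λ_f(n)/(2Λ(n))‖ ≤ 1` (value `0` where `Λ(n) = 0`) under the coefficient bound `‖Λ_f(n)‖ ≤ 2Λ(n)`. [folklore] -/
private theorem norm_halfDatum_le_one {Λf : ℕ → ℂ} (hΛ : ∀ n, ‖Λf n‖ ≤ 2 * Λ n) (n : ℕ) :
    ‖(if (Λ n : ℝ) = 0 then (0 : ℂ) else Λf n / (2 * ((Λ n : ℝ) : ℂ)))‖ ≤ 1 := by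
  split_ifs with h0
  · simp
  · have hpos : 0 < (Λ n : ℝ) := lt_of_le_of_ne ArithmeticFunction.vonMangoldt_nonneg (Ne.symm h0)
    rw [norm_div, show (2 : ℂ) * ((Λ n : ℝ) : ℂ) = ((2 * Λ n : ℝ) : ℂ) by push_cast; ring, Complex.norm_real,
      Real.norm_of_nonneg (by positivity), div_le_one (by positivity)]
    exact hΛ n

/-- Termwise: `Re[(Λ_f h(ℓ) + conj Λ_f h(−ℓ))/√n] = 2·(Λ(n)/√n)·2Re(v(n) h(ℓ))` for ANY key `v` with
`v(n) = Λ_f(n)/(2Λ(n))` where `Λ(n) ≠ 0`, provided `Λ_f(n) = 0` where `Λ(n) = 0` (`h = g ⋆ g̃`, `h(−ℓ) = conj h(ℓ)`). [folklore] -/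
private theorem re_gl2_term_eq_key (g : ℝ → ℂ) {Λf v : ℕ → ℂ} (hz : ∀ n, (Λ n : ℝ) = 0 → Λf n = 0)
    (hv : ∀ n, (Λ n : ℝ) ≠ 0 → v n = Λf n / (2 * ((Λ n : ℝ) : ℂ))) (n : ℕ) :
    ((Λf n * weilConv g (weilReflect g) (Real.log n) +
        conj (Λf n) * weilConv g (weilReflect g) (-Real.log n)) / (Real.sqrt n : ℂ)).re =
      2 * ((Λ n : ℝ) / Real.sqrt n * (2 * (v n * weilConv g (weilReflect g) (Real.log n)).re)) := by
  set h := weilConv g (weilReflect g) with hh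
  have hneg : h (-Real.log n) = conj (h (Real.log n)) := by rw [hh, weilConv_weilReflect_neg]
  have hsum : Λf n * h (Real.log n) + conj (Λf n) * h (-Real.log n) =
      ((2 * (Λf n * h (Real.log n)).re : ℝ) : ℂ) := by rw [hneg, ← map_mul, Complex.add_conj]
  rw [hsum, show ((2 * (Λf n * h (Real.log n)).re : ℝ) : ℂ) / (Real.sqrt n : ℂ) =
      (((2 * (Λf n * h (Real.log n)).re) / Real.sqrt n : ℝ) : ℂ) by push_cast; ring, Complex.ofReal_re]
  by_cases h0 : (Λ n : ℝ) = 0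
  · simp [hz n h0, h0]
  · have hΛc : ((Λ n : ℝ) : ℂ) ≠ 0 := by exact_mod_cast h0
    rw [hv n h0]
    have key : (Λ n : ℝ) * (2 * ((Λf n / (2 * ((Λ n : ℝ) : ℂ))) * h (Real.log n)).re) =
        (Λf n * h (Real.log n)).re := by
      have : (Λf n / (2 * ((Λ n : ℝ) : ℂ))) * h (Real.log n) =
          (((1 / (2 * Λ n) : ℝ)) : ℂ) * (Λf n * h (Real.log n)) := by
        push_cast
        field_simp
      rw [this, Complex.re_ofReal_mul]
      field_simp
    rw [div_mul_eq_mul_div, key.symm]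
    ring

/-! ## GL₂ positivity from ONE certificate: the all-trivial EVEN + ODD key pair at level `(log N)/2` -/

/-- ★★ **GL₂ CERTIFICATE FORMAT.**  Even `k ≥ 2`, `‖Λf n‖ ≤ 2Λ(n)`, `0 < t`: if the SUM of the all-trivial even and odd
key forms of level `(log N)/2` is `≥ 0` at every test function on `[-t, t]`, then `WeilPositivityOnGL2 k N Λf t`
(`Re Q_f ≥ E_{0,(log N)/2,v} + E_{1,(log N)/2,v}`, `v = Λ_f/(2Λ)`, minorant + joint same-window transfer).
[cite: IwaniecKowalski2004, §5.5 Thm 5.12 (5.45); Weil1952FormulesExplicites, (10)–(11) pp. 258–262 and the «lemme» p. 262] -/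
theorem weilPositivityOnGL2_of_allTrivial_pair_nonneg {k N : ℕ} {Λf : ℕ → ℂ} (hk : Even k) (hk2 : 2 ≤ k)
    (hΛ : ∀ n, ‖Λf n‖ ≤ 2 * Λ n) {t : ℝ} (ht : 0 < t)
    (hpos : ∀ h : ℝ → ℂ, IsWeilTest h → tsupport h ⊆ Icc (-t) t →
      0 ≤ keyMarkovForm 0 (Real.log N / 2) (fun _ ↦ 1) t h + keyMarkovForm 1 (Real.log N / 2) (fun _ ↦ 1) t h) :
    WeilPositivityOnGL2 k N Λf t := by
  intro g hg hsupp
  obtain ⟨m, hkm⟩ := hk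
  have hm : 1 ≤ m := by omega
  set N' : ℕ := ⌊Real.exp (2 * t)⌋₊ with hN'
  have hN'1 : Real.exp (2 * t) ≤ (N' : ℝ) + 1 := (Nat.lt_floor_add_one _).le
  have hM1 : 1 ≤ N' + 1 := by omega
  have hM : 2 * t ≤ Real.log ((N' + 1 : ℕ) : ℝ) := by
    rw [Real.le_log_iff_exp_le (by positivity)]; exact_mod_cast hN'1
  have hQ := re_weilQuadraticGL2_eq_of_le_log (k := k) (N := N) (Λf := Λf) hg hsupp hM1 hM
  have hk2c : ∀ τ : ℝ, ((k : ℂ) / 2 + τ * I) = ((m : ℂ) + τ * I) := by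
    intro τ; rw [hkm]; push_cast; ring
  simp_rw [hk2c] at hQ
  set Ng : ℝ := ∫ x : ℝ, ‖g x‖ ^ 2 with hNg
  set A0 : ℝ := ∫ τ : ℝ, ‖weilMellin g (1 / 2 + τ * I)‖ ^ 2 * (digamma (1 / 4 + τ / 2 * I)).re with hA0
  set A1 : ℝ := ∫ τ : ℝ, ‖weilMellin g (1 / 2 + τ * I)‖ ^ 2 * (digamma (3 / 4 + τ / 2 * I)).re with hA1
  set Am : ℝ := ∫ τ : ℝ, ‖weilMellin g (1 / 2 + τ * I)‖ ^ 2 * (digamma ((m : ℂ) + τ * I)).re with hAm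
  -- integrability of the three archimedean integrands
  have hi0 := integrable_normSq_mul_re_digamma hg (x := 1 / 4) (by norm_num)
  have e0 : ∀ τ : ℝ, (((1 / 4 : ℝ) : ℂ) + τ / 2 * I) = 1 / 4 + (τ : ℂ) / 2 * I := by intro τ; push_cast; ring
  simp_rw [e0] at hi0
  have hi1 := integrable_normSq_mul_re_digamma hg (x := 3 / 4) (by norm_num)
  have e1 : ∀ τ : ℝ, (((3 / 4 : ℝ) : ℂ) + τ / 2 * I) = 3 / 4 + (τ : ℂ) / 2 * I := by intro τ; push_cast; ring
  simp_rw [e1] at hi1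
  have hm0 : (0 : ℝ) < m := by exact_mod_cast hm
  have him := integrable_normSq_mul_re_digamma_line hg hm0
  -- the two-parity density comparison, integrated: A0 + A1 + 4π log 2 · Ng ≤ 2 Am
  have hPl : ∫ τ : ℝ, ‖weilMellin g (1 / 2 + τ * I)‖ ^ 2 = 2 * π * Ng := integral_norm_sq_weilMellin_half_line hg
  have hA : A0 + A1 + 4 * π * Real.log 2 * Ng ≤ 2 * Am := by
    have hc : Integrable fun τ : ℝ ↦ ‖weilMellin g (1 / 2 + τ * I)‖ ^ 2 * (2 * Real.log 2) :=
      (integrable_norm_sq_weilMellin_half_line hg).mul_const _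
    have h01 : Integrable (fun τ : ℝ ↦ ‖weilMellin g (1 / 2 + τ * I)‖ ^ 2 * (digamma (1 / 4 + τ / 2 * I)).re +
        ‖weilMellin g (1 / 2 + τ * I)‖ ^ 2 * (digamma (3 / 4 + τ / 2 * I)).re) := hi0.add hi1
    have hsum : (∫ τ : ℝ, (‖weilMellin g (1 / 2 + τ * I)‖ ^ 2 * (digamma (1 / 4 + τ / 2 * I)).re +
        ‖weilMellin g (1 / 2 + τ * I)‖ ^ 2 * (digamma (3 / 4 + τ / 2 * I)).re +
        ‖weilMellin g (1 / 2 + τ * I)‖ ^ 2 * (2 * Real.log 2))) = A0 + A1 + 4 * π * Real.log 2 * Ng := by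
      rw [integral_add h01 hc, integral_add hi0 hi1, integral_mul_const, hPl]
      ring
    have h2 : (∫ τ : ℝ, 2 * (‖weilMellin g (1 / 2 + τ * I)‖ ^ 2 * (digamma ((m : ℂ) + τ * I)).re)) = 2 * Am := by
      rw [integral_const_mul]
    rw [← hsum, ← h2]
    refine integral_mono (h01.add hc) (him.const_mul 2) fun τ ↦ ?_
    have hdup := re_digamma_quarter_add_three_quarters τ
    have e2 : (1 / 4 + ((τ / 2 : ℝ) : ℂ) * I) = 1 / 4 + (τ : ℂ) / 2 * I := by push_cast; ring
    have e3 : (3 / 4 + ((τ / 2 : ℝ) : ℂ) * I) = 3 / 4 + (τ : ℂ) / 2 * I := by push_cast; ring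
    rw [e2, e3] at hdup
    have hhalf := re_digamma_half_add_le_re_digamma_one_add τ
    have hstep := re_digamma_one_add_le_re_digamma_nat_add τ hm
    have hn : 0 ≤ ‖weilMellin g (1 / 2 + τ * I)‖ ^ 2 := by positivity
    simp only
    nlinarith
  -- the prime sum and the two key forms of the halved datum
  set v : ℕ → ℂ := (fun n : ℕ ↦ if (Λ n : ℝ) = 0 then (0 : ℂ) else Λf n / (2 * ((Λ n : ℝ) : ℂ))) with hv
  have hvn : ∀ n, ‖v n‖ ≤ 1 := fun n ↦ by rw [hv]; exact norm_halfDatum_le_one hΛ n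
  have hz : ∀ n, (Λ n : ℝ) = 0 → Λf n = 0 := fun n h0 ↦ by
    have := hΛ n
    rw [h0, mul_zero] at this
    exact norm_le_zero_iff.1 this
  have hv' : ∀ n, (Λ n : ℝ) ≠ 0 → v n = Λf n / (2 * ((Λ n : ℝ) : ℂ)) := fun n h0 ↦ by simp only [hv, if_neg h0]
  have hD : (∑ n ∈ range (N' + 1), (Λf n * weilConv g (weilReflect g) (Real.log n) +
        conj (Λf n) * weilConv g (weilReflect g) (-Real.log n)) / (Real.sqrt n : ℂ)).re =
      2 * ∑ n ∈ range (N' + 1), (Λ n : ℝ) / Real.sqrt n *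
        (2 * (v n * weilConv g (weilReflect g) (Real.log n)).re) := by
    rw [Complex.re_sum, Finset.mul_sum]
    exact Finset.sum_congr rfl fun n _ ↦ re_gl2_term_eq_key g hz hv' n
  set Sp : ℝ := ∑ n ∈ range (N' + 1), (Λ n : ℝ) / Real.sqrt n *
    (2 * (v n * weilConv g (weilReflect g) (Real.log n)).re) with hSp
  have hEa : ∀ (a : ℕ) (Aa : ℝ), (Aa = ∫ τ : ℝ, ‖weilMellin g (1 / 2 + τ * I)‖ ^ 2 *
        (digamma (1 / 4 + (a : ℂ) / 2 + τ / 2 * I)).re) →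
      weilFinitePrimeQuadraticKey a 0 v N' g = 1 / (2 * π) * Aa - Real.log π * Ng - Sp := by
    intro a Aa hAa
    have hia := integrable_normSq_mul_re_digamma hg (x := 1 / 4 + a / 2) (by positivity)
    have ea : ∀ τ : ℝ, (((1 / 4 + a / 2 : ℝ) : ℂ) + τ / 2 * I) = 1 / 4 + (a : ℂ) / 2 + τ / 2 * I := by
      intro τ; push_cast; ring
    simp_rw [ea] at hia
    rw [weilFinitePrimeQuadraticKey_eq_zero_key_sub_spikes hg a 0 v N', ← hSp]
    have hz : ∀ τ : ℝ, weilPrimeRippleKey 0 N' τ = 0 := fun τ ↦ by unfold weilPrimeRippleKey; simp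
    have hw : ∀ τ : ℝ, weilFinitePrimeWeightKey a 0 0 N' τ =
        (digamma (1 / 4 + (a : ℂ) / 2 + τ / 2 * I)).re + (-Real.log π) := by
      intro τ; rw [weilFinitePrimeWeightKey, hz]; ring
    have e : (fun τ : ℝ ↦ ‖weilMellin g (1 / 2 + τ * I)‖ ^ 2 * weilFinitePrimeWeightKey a 0 0 N' τ) =
        fun τ : ℝ ↦ ‖weilMellin g (1 / 2 + τ * I)‖ ^ 2 * (digamma (1 / 4 + (a : ℂ) / 2 + τ / 2 * I)).re +
          ‖weilMellin g (1 / 2 + τ * I)‖ ^ 2 * (-Real.log π) := by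
      funext τ; rw [hw]; ring
    have hc : Integrable fun τ : ℝ ↦ ‖weilMellin g (1 / 2 + τ * I)‖ ^ 2 * (-Real.log π) :=
      (integrable_norm_sq_weilMellin_half_line hg).mul_const _
    unfold weilFinitePrimeQuadraticKey
    rw [e, integral_add hia hc, integral_mul_const, hPl, ← hAa]
    have hπ : (π : ℝ) ≠ 0 := Real.pi_pos.ne'
    generalize Aa = A at *
    generalize Sp = Ssum
    field_simp
    ring
  have hE0 : weilFinitePrimeQuadraticKey 0 0 v N' g = 1 / (2 * π) * A0 - Real.log π * Ng - Sp :=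
    hEa 0 A0 (by rw [hA0]; congr 1; funext τ; push_cast; ring_nf)
  have hE1 : weilFinitePrimeQuadraticKey 1 0 v N' g = 1 / (2 * π) * A1 - Real.log π * Ng - Sp :=
    hEa 1 A1 (by rw [hA1]; congr 1; funext τ; push_cast; ring_nf)
  -- positivity of the pair at level `(log N)/2`
  have hpair : 0 ≤ weilFinitePrimeQuadraticKey 0 (Real.log N / 2) v N' g +
      weilFinitePrimeQuadraticKey 1 (Real.log N / 2) v N' g := by
    rw [← keyMarkovForm_eq_weilFinitePrimeQuadraticKey hg hsupp hN'1 (a := 0) (Nat.zero_le _),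
      ← keyMarkovForm_eq_weilFinitePrimeQuadraticKey hg hsupp hN'1 (a := 1) le_rfl]
    exact keyMarkovForm_add_nonneg_of_allTrivial_test_nonneg ht hpos hvn le_rfl hg hsupp
  have hs0 := weilFinitePrimeQuadraticKey_eq_add_norm hg 0 0 (Real.log N / 2) v N'
  have hs1 := weilFinitePrimeQuadraticKey_eq_add_norm hg 1 0 (Real.log N / 2) v N'
  have hNrm : weilNorm2Sq g = Ng := rfl
  rw [hNrm] at hs0 hs1
  -- assemble
  have hπ : 0 < π := Real.pi_pos
  have hlog2π : Real.log (2 * π) = Real.log 2 + Real.log π := Real.log_mul (by norm_num) hπ.ne'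
  rw [hQ, hD, hlog2π]
  rw [hs0, hs1, hE0, hE1] at hpair
  have hq : 1 / π * Am ≥ 1 / (2 * π) * A0 + 1 / (2 * π) * A1 + 2 * Real.log 2 * Ng := by
    have := mul_le_mul_of_nonneg_left hA (show (0 : ℝ) ≤ 1 / (2 * π) by positivity)
    have e4 : 1 / (2 * π) * (A0 + A1 + 4 * π * Real.log 2 * Ng) =
        1 / (2 * π) * A0 + 1 / (2 * π) * A1 + 2 * Real.log 2 * Ng := by field_simp; ring
    have e5 : 1 / (2 * π) * (2 * Am) = 1 / π * Am := by field_simp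
    linarith
  nlinarith [hpair, hq]

/-! ## The GL₂ level law with the parity bonus -/

/-- ★ **Ground-energy form.**  Even `k ≥ 2`, `‖Λf n‖ ≤ 2Λ(n)`, `0 < t`, `2β² < 1` and
`4(sinh t + t + 2βt + β² tanh(t/2)) ≤ (1 − 2β²)(log N + 2·weilGroundEnergy t)` ⇒ `WeilPositivityOnGL2 k N Λf t`
(a certified lower bound `−δ ≤ weilGroundEnergy t` thus costs the factor `e^{2δ}` in the level). [folklore] -/
theorem weilPositivityOnGL2_of_groundEnergy_parity {k N : ℕ} {Λf : ℕ → ℂ} (hk : Even k) (hk2 : 2 ≤ k)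
    (hΛ : ∀ n, ‖Λf n‖ ≤ 2 * Λ n) {t : ℝ} (ht : 0 < t) {β : ℝ} (hβ : 2 * β ^ 2 < 1)
    (hN : 4 * (Real.sinh t + t + 2 * β * t + β ^ 2 * Real.tanh (t / 2)) ≤
      (1 - 2 * β ^ 2) * (Real.log N + 2 * weilGroundEnergy t)) : WeilPositivityOnGL2 k N Λf t :=
  weilPositivityOnGL2_of_allTrivial_pair_nonneg hk hk2 hΛ ht fun _ hh hs ↦
    keyMarkovForm_allTrivial_pair_nonneg_of_groundEnergy ht.le hβ (by linarith) hh hs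

/-- ★★ **THE GL₂ LEVEL LAW WITH THE PARITY BONUS.**  Even `k ≥ 2`, `‖Λf n‖ ≤ 2Λ(n)`, `0 < t`, `WeilPositivityOn t`,
`2β² < 1` and `4(sinh t + t + 2βt + β² tanh(t/2)) ≤ (1 − 2β²) log N` ⇒ `WeilPositivityOnGL2 k N Λf t`.
[cite: IwaniecKowalski2004, §5.5 Thm 5.12 (5.45); Bombieri2000, §4 Problem 2] -/
theorem weilPositivityOnGL2_of_weilPositivityOn_parity {k N : ℕ} {Λf : ℕ → ℂ} (hk : Even k) (hk2 : 2 ≤ k)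
    (hΛ : ∀ n, ‖Λf n‖ ≤ 2 * Λ n) {t : ℝ} (ht : 0 < t) (hζ : WeilPositivityOn t) {β : ℝ} (hβ : 2 * β ^ 2 < 1)
    (hN : 4 * (Real.sinh t + t + 2 * β * t + β ^ 2 * Real.tanh (t / 2)) ≤ (1 - 2 * β ^ 2) * Real.log N) :
    WeilPositivityOnGL2 k N Λf t := by
  have hE : 0 ≤ weilGroundEnergy t := by
    unfold weilGroundEnergy
    refine Real.sInf_nonneg ?_
    rintro x ⟨h, hh, hs, -, rfl⟩
    exact hζ h hh hs
  refine weilPositivityOnGL2_of_groundEnergy_parity hk hk2 hΛ ht hβ (hN.trans ?_)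
  exact mul_le_mul_of_nonneg_left (by linarith) (by linarith)

/-- The law with an INTEGER floor `N₀ ≤ N`. [folklore] -/
theorem weilPositivityOnGL2_of_weilPositivityOn_parity_of_le {k N : ℕ} {Λf : ℕ → ℂ} (hk : Even k) (hk2 : 2 ≤ k)
    (hΛ : ∀ n, ‖Λf n‖ ≤ 2 * Λ n) {t : ℝ} (ht : 0 < t) (hζ : WeilPositivityOn t) {β : ℝ} (hβ : 2 * β ^ 2 < 1)
    {N₀ : ℕ} (hN1 : 1 < N₀)
    (hN₀ : 4 * (Real.sinh t + t + 2 * β * t + β ^ 2 * Real.tanh (t / 2)) ≤ (1 - 2 * β ^ 2) * Real.log N₀)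
    (hle : N₀ ≤ N) : WeilPositivityOnGL2 k N Λf t := by
  refine weilPositivityOnGL2_of_weilPositivityOn_parity hk hk2 hΛ ht hζ hβ (hN₀.trans ?_)
  exact mul_le_mul_of_nonneg_left
    (Real.log_le_log (by exact_mod_cast (show 0 < N₀ by omega)) (by exact_mod_cast hle)) (by linarith)

end Summit.Ventures.WeilGRH

end
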